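import Mathlib
import HarnessLib
import Literature.Combinatorics.SimpleGraph.PathSubdivision
import Summits.ValiantsHypothesis.ValiantsHypothesis.Theorems.MonotoneRestorationMonotoneRestorationQPLinearWidthMinorTrans

/-!
# Route MonotoneRestoration, crux `MonotoneRestorationQP` (stmt-15886), line `linear_width` —
# THE 5-SUBDIVIDED WALL DRAWN ALONG THE GRID LINES; hence a topological minor of every graph with a large grid minor

Helper file (`--supports stmt-ValiantsHypothesis-15886`), def-free.  Item (K) of the g15 residue list (supply chain behind
`CFIOddCover.widthRung_sqrt_of_chains`, p842034).

The odd-cover witnesses need, inside a wide pattern, a subdivided wall whose wall edges have become paths of length `≥ 6`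
(so that parities can be repaired by one extra subdivision with slack).  With the general subdivision `psubdiv`
(`Literature/Combinatorics/SimpleGraph/PathSubdivision.lean`, p841989) the right object is
`H_r = psubdiv (wall r) (fun _ => 5) 5` — every wall edge carries `5` new vertices.  Here:

* `exists_hom_psubdivWall_grid` — **`H_r` maps injectively and edge-preservingly into `grid (6r) (6r)`**: the wall vertex
  `(i, j)` goes to `(6i, 6j)` and the `t`-th new vertex of the edge `pq` (`(p, q) = edgeOut e`) to the lattice point
  `(5 - t)·p + (t + 1)·q` on the segment from `6p` to `6q`;
* `psubdivWall_neighbors_le_three` — `H_r` is subcubic (`psubdiv_neighbors_le_three` + `wall_neighbors_le_three`);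
* **`psubdivWall_isTopologicalMinor_of_grid_isMinor`** — `grid (6r) (6r) ≼ₘ F ⇒ H_r ≼ₜ F` (`isTopologicalMinor_of_subcubic_of_grid`,
  p841952): every graph with a `(6r) × (6r)` grid minor contains a subdivision of the wall `W_r` in which EVERY WALL EDGE IS
  A PATH OF LENGTH `≥ 6`;
* `isMinor_wall_psubdivWall`, `le_treewidth_psubdivWall` — `W_r ≼ₘ H_r`, so `tw H_r ≥ ⌊(r-1)/2⌋`.

Honest label: combinatorial plumbing; no stub closed; θ₁, the cruxes and VP ≠ VNP NOT moved.
[cite: Diestel2010, §1.7 (Prop. 1.7.2 (ii)); GalesiEtAl2023, §2 and Cor. 9]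
-/

set_option linter.dupNamespace false

noncomputable section

open scoped Classical
open scoped Literature.Combinatorics.SimpleGraph

namespace Summit.ValiantsHypothesis.ValiantsHypothesis.Theorems.CFIOddCover

open Literature.Combinatorics.SimpleGraph

/-! ### Arithmetic of the stretched segment -/

/-- `(5 - t)·a + (t + 1)·a = 6a` for `t ≤ 5`. [folklore] -/
theorem stretch_same {t : ℕ} (ht : t < 5) (a : ℕ) : (5 - t) * a + (t + 1) * a = 6 * a := by
  interval_cases t <;> omega

/-- `(5 - t)·a + (t + 1)·(a + 1) = 6a + (t + 1)` for `t ≤ 5`. [folklore] -/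
theorem stretch_up {t : ℕ} (ht : t < 5) (a : ℕ) : (5 - t) * a + (t + 1) * (a + 1) = 6 * a + (t + 1) := by
  interval_cases t <;> omega

/-- `(5 - t)·(a + 1) + (t + 1)·a = 6a + (5 - t)` for `t ≤ 5`. [folklore] -/
theorem stretch_down {t : ℕ} (ht : t < 5) (a : ℕ) : (5 - t) * (a + 1) + (t + 1) * a = 6 * a + (5 - t) := by
  interval_cases t <;> omega

/-! ### The drawing -/

/-- **The 5-subdivided wall drawn along the grid lines.**  There is an injective homomorphism
`psubdiv (wall r) (fun _ => 5) 5 →g grid (6r) (6r)`: wall vertices `(i,j) ↦ (6i,6j)`, the `t`-th inner vertex (`t < 5`) of the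
wall edge with chosen ends `(p, q)` `↦ (5-t)·p + (t+1)·q` (coordinatewise). [cite: GalesiEtAl2023, §2 (walls in grids)] -/
theorem exists_hom_psubdivWall_grid (r : ℕ) :
    ∃ σ : psubdiv (wall r) (fun _ => 5) 5 →g grid (6 * r) (6 * r), Function.Injective σ := by
  classical
  -- geometry of a wall edge: the chosen ends differ by one in exactly one coordinate
  have hgeom : ∀ e ∈ (wall r).edgeSet,
      (((edgeOut e).1.1 : ℕ) = (edgeOut e).2.1 ∧
          (((edgeOut e).1.2 : ℕ) + 1 = (edgeOut e).2.2 ∨ ((edgeOut e).2.2 : ℕ) + 1 = (edgeOut e).1.2)) ∨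
        (((edgeOut e).1.2 : ℕ) = (edgeOut e).2.2 ∧
          (((edgeOut e).1.1 : ℕ) + 1 = (edgeOut e).2.1 ∨ ((edgeOut e).2.1 : ℕ) + 1 = (edgeOut e).1.1)) :=
    fun e he => by
      have h := grid_adj.1 (wall_le_grid r (adj_edgeOut he))
      simpa only [Fin.ext_iff] using h
  -- the coordinates of the drawing
  let cx : PSubdivVertex (wall r) (fun _ => 5) 5 → ℕ := fun x =>
    match x with
    | .inl p => 6 * p.1
    | .inr y => (5 - (y.1.2 : ℕ)) * ((edgeOut y.1.1).1.1 : ℕ) + ((y.1.2 : ℕ) + 1) * ((edgeOut y.1.1).2.1 : ℕ)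
  let cy : PSubdivVertex (wall r) (fun _ => 5) 5 → ℕ := fun x =>
    match x with
    | .inl p => 6 * p.2
    | .inr y => (5 - (y.1.2 : ℕ)) * ((edgeOut y.1.1).1.2 : ℕ) + ((y.1.2 : ℕ) + 1) * ((edgeOut y.1.1).2.2 : ℕ)
  -- normal forms of the inner coordinates (linear in the position)
  have hnx : ∀ y : {p : Sym2 (Fin (r + 1) × Fin (r + 1)) × Fin 5 // p.1 ∈ (wall r).edgeSet ∧ (p.2 : ℕ) < 5},
      (cx (.inr y) = 6 * (edgeOut y.1.1).1.1 ∧ ((edgeOut y.1.1).1.1 : ℕ) = (edgeOut y.1.1).2.1) ∨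
      (cx (.inr y) = 6 * (edgeOut y.1.1).1.1 + ((y.1.2 : ℕ) + 1) ∧
        ((edgeOut y.1.1).1.1 : ℕ) + 1 = (edgeOut y.1.1).2.1) ∨
      (cx (.inr y) = 6 * (edgeOut y.1.1).2.1 + (5 - (y.1.2 : ℕ)) ∧
        ((edgeOut y.1.1).2.1 : ℕ) + 1 = (edgeOut y.1.1).1.1) := by
    intro y
    have ht : (y.1.2 : ℕ) < 5 := y.1.2.is_lt
    rcases hgeom y.1.1 y.2.1 with ⟨h1, -⟩ | ⟨-, h1 | h1⟩
    · refine Or.inl ⟨?_, h1⟩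
      show (5 - (y.1.2 : ℕ)) * ((edgeOut y.1.1).1.1 : ℕ) + ((y.1.2 : ℕ) + 1) * ((edgeOut y.1.1).2.1 : ℕ) = _
      rw [← h1, stretch_same ht]
    · refine Or.inr (Or.inl ⟨?_, h1⟩)
      show (5 - (y.1.2 : ℕ)) * ((edgeOut y.1.1).1.1 : ℕ) + ((y.1.2 : ℕ) + 1) * ((edgeOut y.1.1).2.1 : ℕ) = _
      rw [← h1, stretch_up ht]
    · refine Or.inr (Or.inr ⟨?_, h1⟩)
      show (5 - (y.1.2 : ℕ)) * ((edgeOut y.1.1).1.1 : ℕ) + ((y.1.2 : ℕ) + 1) * ((edgeOut y.1.1).2.1 : ℕ) = _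
      rw [← h1, stretch_down ht]
  have hny : ∀ y : {p : Sym2 (Fin (r + 1) × Fin (r + 1)) × Fin 5 // p.1 ∈ (wall r).edgeSet ∧ (p.2 : ℕ) < 5},
      (cy (.inr y) = 6 * (edgeOut y.1.1).1.2 ∧ ((edgeOut y.1.1).1.2 : ℕ) = (edgeOut y.1.1).2.2) ∨
      (cy (.inr y) = 6 * (edgeOut y.1.1).1.2 + ((y.1.2 : ℕ) + 1) ∧
        ((edgeOut y.1.1).1.2 : ℕ) + 1 = (edgeOut y.1.1).2.2) ∨
      (cy (.inr y) = 6 * (edgeOut y.1.1).2.2 + (5 - (y.1.2 : ℕ)) ∧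
        ((edgeOut y.1.1).2.2 : ℕ) + 1 = (edgeOut y.1.1).1.2) := by
    intro y
    have ht : (y.1.2 : ℕ) < 5 := y.1.2.is_lt
    rcases hgeom y.1.1 y.2.1 with ⟨-, h1 | h1⟩ | ⟨h1, -⟩
    · refine Or.inr (Or.inl ⟨?_, h1⟩)
      show (5 - (y.1.2 : ℕ)) * ((edgeOut y.1.1).1.2 : ℕ) + ((y.1.2 : ℕ) + 1) * ((edgeOut y.1.1).2.2 : ℕ) = _
      rw [← h1, stretch_up ht]
    · refine Or.inr (Or.inr ⟨?_, h1⟩)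
      show (5 - (y.1.2 : ℕ)) * ((edgeOut y.1.1).1.2 : ℕ) + ((y.1.2 : ℕ) + 1) * ((edgeOut y.1.1).2.2 : ℕ) = _
      rw [← h1, stretch_down ht]
    · refine Or.inl ⟨?_, h1⟩
      show (5 - (y.1.2 : ℕ)) * ((edgeOut y.1.1).1.2 : ℕ) + ((y.1.2 : ℕ) + 1) * ((edgeOut y.1.1).2.2 : ℕ) = _
      rw [← h1, stretch_same ht]
  -- pointwise normal forms (no disjunctions), for the heavier arithmetic below
  have hx_same : ∀ y : {p : Sym2 (Fin (r + 1) × Fin (r + 1)) × Fin 5 // p.1 ∈ (wall r).edgeSet ∧ (p.2 : ℕ) < 5},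
      ((edgeOut y.1.1).1.1 : ℕ) = (edgeOut y.1.1).2.1 → cx (.inr y) = 6 * (edgeOut y.1.1).1.1 := by
    intro y h1
    show (5 - (y.1.2 : ℕ)) * ((edgeOut y.1.1).1.1 : ℕ) + ((y.1.2 : ℕ) + 1) * ((edgeOut y.1.1).2.1 : ℕ) = _
    rw [← h1, stretch_same y.1.2.is_lt]
  have hx_up : ∀ y : {p : Sym2 (Fin (r + 1) × Fin (r + 1)) × Fin 5 // p.1 ∈ (wall r).edgeSet ∧ (p.2 : ℕ) < 5},
      ((edgeOut y.1.1).1.1 : ℕ) + 1 = (edgeOut y.1.1).2.1 → cx (.inr y) = 6 * (edgeOut y.1.1).1.1 + ((y.1.2 : ℕ) + 1) := by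
    intro y h1
    show (5 - (y.1.2 : ℕ)) * ((edgeOut y.1.1).1.1 : ℕ) + ((y.1.2 : ℕ) + 1) * ((edgeOut y.1.1).2.1 : ℕ) = _
    rw [← h1, stretch_up y.1.2.is_lt]
  have hx_down : ∀ y : {p : Sym2 (Fin (r + 1) × Fin (r + 1)) × Fin 5 // p.1 ∈ (wall r).edgeSet ∧ (p.2 : ℕ) < 5},
      ((edgeOut y.1.1).2.1 : ℕ) + 1 = (edgeOut y.1.1).1.1 → cx (.inr y) = 6 * (edgeOut y.1.1).2.1 + (5 - (y.1.2 : ℕ)) := by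
    intro y h1
    show (5 - (y.1.2 : ℕ)) * ((edgeOut y.1.1).1.1 : ℕ) + ((y.1.2 : ℕ) + 1) * ((edgeOut y.1.1).2.1 : ℕ) = _
    rw [← h1, stretch_down y.1.2.is_lt]
  have hy_same : ∀ y : {p : Sym2 (Fin (r + 1) × Fin (r + 1)) × Fin 5 // p.1 ∈ (wall r).edgeSet ∧ (p.2 : ℕ) < 5},
      ((edgeOut y.1.1).1.2 : ℕ) = (edgeOut y.1.1).2.2 → cy (.inr y) = 6 * (edgeOut y.1.1).1.2 := by
    intro y h1
    show (5 - (y.1.2 : ℕ)) * ((edgeOut y.1.1).1.2 : ℕ) + ((y.1.2 : ℕ) + 1) * ((edgeOut y.1.1).2.2 : ℕ) = _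
    rw [← h1, stretch_same y.1.2.is_lt]
  have hy_up : ∀ y : {p : Sym2 (Fin (r + 1) × Fin (r + 1)) × Fin 5 // p.1 ∈ (wall r).edgeSet ∧ (p.2 : ℕ) < 5},
      ((edgeOut y.1.1).1.2 : ℕ) + 1 = (edgeOut y.1.1).2.2 → cy (.inr y) = 6 * (edgeOut y.1.1).1.2 + ((y.1.2 : ℕ) + 1) := by
    intro y h1
    show (5 - (y.1.2 : ℕ)) * ((edgeOut y.1.1).1.2 : ℕ) + ((y.1.2 : ℕ) + 1) * ((edgeOut y.1.1).2.2 : ℕ) = _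
    rw [← h1, stretch_up y.1.2.is_lt]
  have hy_down : ∀ y : {p : Sym2 (Fin (r + 1) × Fin (r + 1)) × Fin 5 // p.1 ∈ (wall r).edgeSet ∧ (p.2 : ℕ) < 5},
      ((edgeOut y.1.1).2.2 : ℕ) + 1 = (edgeOut y.1.1).1.2 → cy (.inr y) = 6 * (edgeOut y.1.1).2.2 + (5 - (y.1.2 : ℕ)) := by
    intro y h1
    show (5 - (y.1.2 : ℕ)) * ((edgeOut y.1.1).1.2 : ℕ) + ((y.1.2 : ℕ) + 1) * ((edgeOut y.1.1).2.2 : ℕ) = _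
    rw [← h1, stretch_down y.1.2.is_lt]
  -- bounds
  have hbx : ∀ x, cx x < 6 * r + 1 := by
    rintro (p | y)
    · show 6 * (p.1 : ℕ) < 6 * r + 1
      have := p.1.is_lt; omega
    · have h1 := (edgeOut y.1.1).1.1.is_lt
      have h2 := (edgeOut y.1.1).2.1.is_lt
      have ht : (y.1.2 : ℕ) < 5 := y.1.2.is_lt
      rcases hnx y with ⟨h, h'⟩ | ⟨h, h'⟩ | ⟨h, h'⟩ <;> omega
  have hby : ∀ x, cy x < 6 * r + 1 := by
    rintro (p | y)
    · show 6 * (p.2 : ℕ) < 6 * r + 1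
      have := p.2.is_lt; omega
    · have h1 := (edgeOut y.1.1).1.2.is_lt
      have h2 := (edgeOut y.1.1).2.2.is_lt
      have ht : (y.1.2 : ℕ) < 5 := y.1.2.is_lt
      rcases hny y with ⟨h, h'⟩ | ⟨h, h'⟩ | ⟨h, h'⟩ <;> omega
  -- coordinates of a wall vertex equal to a chosen end
  have hend : ∀ (p : Fin (r + 1) × Fin (r + 1)) (q : Fin (r + 1) × Fin (r + 1)), p = q →
      ((p.1 : ℕ) = q.1 ∧ (p.2 : ℕ) = q.2) := fun p q h => by subst h; exact ⟨rfl, rfl⟩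
  -- the homomorphism
  have hmap : ∀ x y, (psubdiv (wall r) (fun _ => 5) 5).Adj x y →
      (grid (6 * r) (6 * r)).Adj (⟨cx x, hbx x⟩, ⟨cy x, hby x⟩) (⟨cx y, hbx y⟩, ⟨cy y, hby y⟩) := by
    intro x y hxy
    rw [grid_adj]
    simp only [Fin.ext_iff]
    rcases x with p | z <;> rcases y with p' | z'
    · rw [psubdiv_adj_inl_inl] at hxy
      exact absurd hxy.2 (by norm_num)
    · rw [psubdiv_adj_inl_inr] at hxy
      have hgx := hnx z'
      have hgy := hny z'
      have ht : (z'.1.2 : ℕ) < 5 := z'.1.2.is_lt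
      show (6 * (p.1 : ℕ) = cx (.inr z') ∧ _ ∨ _)
      change (6 * (p.1 : ℕ) = cx (.inr z') ∧ (6 * (p.2 : ℕ) + 1 = cy (.inr z') ∨ cy (.inr z') + 1 = 6 * (p.2 : ℕ))) ∨
        (6 * (p.2 : ℕ) = cy (.inr z') ∧ (6 * (p.1 : ℕ) + 1 = cx (.inr z') ∨ cx (.inr z') + 1 = 6 * (p.1 : ℕ)))
      rcases hxy with ⟨hp, ht0⟩ | ⟨hp, ht4⟩
      · obtain ⟨e1, e2⟩ := hend _ _ hp
        rcases hgeom z'.1.1 z'.2.1 with ⟨g1, g2 | g2⟩ | ⟨g1, g2 | g2⟩ <;> omega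
      · obtain ⟨e1, e2⟩ := hend _ _ hp
        rcases hgeom z'.1.1 z'.2.1 with ⟨g1, g2 | g2⟩ | ⟨g1, g2 | g2⟩ <;> omega
    · rw [psubdiv_adj_inr_inl] at hxy
      have hgx := hnx z
      have hgy := hny z
      have ht : (z.1.2 : ℕ) < 5 := z.1.2.is_lt
      change (cx (.inr z) = 6 * (p'.1 : ℕ) ∧ (cy (.inr z) + 1 = 6 * (p'.2 : ℕ) ∨ 6 * (p'.2 : ℕ) + 1 = cy (.inr z))) ∨
        (cy (.inr z) = 6 * (p'.2 : ℕ) ∧ (cx (.inr z) + 1 = 6 * (p'.1 : ℕ) ∨ 6 * (p'.1 : ℕ) + 1 = cx (.inr z)))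
      rcases hxy with ⟨hp, ht0⟩ | ⟨hp, ht4⟩
      · obtain ⟨e1, e2⟩ := hend _ _ hp
        rcases hgeom z.1.1 z.2.1 with ⟨g1, g2 | g2⟩ | ⟨g1, g2 | g2⟩ <;> omega
      · obtain ⟨e1, e2⟩ := hend _ _ hp
        rcases hgeom z.1.1 z.2.1 with ⟨g1, g2 | g2⟩ | ⟨g1, g2 | g2⟩ <;> omega
    · rw [psubdiv_adj_inr_inr] at hxy
      obtain ⟨he, ht⟩ := hxy
      have hgx := hnx z
      have hgy := hny z
      have hgx' := hnx z'
      have hgy' := hny z'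
      have ht5 : (z.1.2 : ℕ) < 5 := z.1.2.is_lt
      have ht5' : (z'.1.2 : ℕ) < 5 := z'.1.2.is_lt
      rw [← he] at hgx' hgy'
      change (cx (.inr z) = cx (.inr z') ∧ (cy (.inr z) + 1 = cy (.inr z') ∨ cy (.inr z') + 1 = cy (.inr z))) ∨
        (cy (.inr z) = cy (.inr z') ∧ (cx (.inr z) + 1 = cx (.inr z') ∨ cx (.inr z') + 1 = cx (.inr z)))
      rcases hgeom z.1.1 z.2.1 with ⟨g1, g2 | g2⟩ | ⟨g1, g2 | g2⟩ <;> omega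
  refine ⟨⟨fun x => (⟨cx x, hbx x⟩, ⟨cy x, hby x⟩), fun {x y} h => hmap x y h⟩, ?_⟩
  -- injectivity
  intro x y hxy
  have h1 : cx x = cx y := by
    have := congrArg (fun p : Fin (6 * r + 1) × Fin (6 * r + 1) => (p.1 : ℕ)) hxy; exact this
  have h2 : cy x = cy y := by
    have := congrArg (fun p : Fin (6 * r + 1) × Fin (6 * r + 1) => (p.2 : ℕ)) hxy; exact this
  rcases x with p | z <;> rcases y with p' | z'
  · have e1 : (p.1 : ℕ) = p'.1 := by change 6 * (p.1 : ℕ) = 6 * p'.1 at h1; omega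
    have e2 : (p.2 : ℕ) = p'.2 := by change 6 * (p.2 : ℕ) = 6 * p'.2 at h2; omega
    rw [show p = p' from Prod.ext (Fin.ext e1) (Fin.ext e2)]
  · exfalso
    have hgx := hnx z'
    have hgy := hny z'
    have ht : (z'.1.2 : ℕ) < 5 := z'.1.2.is_lt
    change 6 * (p.1 : ℕ) = cx (.inr z') at h1
    change 6 * (p.2 : ℕ) = cy (.inr z') at h2
    rcases hgeom z'.1.1 z'.2.1 with ⟨g1, g2 | g2⟩ | ⟨g1, g2 | g2⟩ <;> omega
  · exfalso
    have hgx := hnx z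
    have hgy := hny z
    have ht : (z.1.2 : ℕ) < 5 := z.1.2.is_lt
    change cx (.inr z) = 6 * (p'.1 : ℕ) at h1
    change cy (.inr z) = 6 * (p'.2 : ℕ) at h2
    rcases hgeom z.1.1 z.2.1 with ⟨g1, g2 | g2⟩ | ⟨g1, g2 | g2⟩ <;> omega
  · -- two inner vertices: first the segments coincide (with the positions), then the edges
    have ht5 : (z.1.2 : ℕ) < 5 := z.1.2.is_lt
    have ht5' : (z'.1.2 : ℕ) < 5 := z'.1.2.is_lt
    change cx (.inr z) = cx (.inr z') at h1
    change cy (.inr z) = cy (.inr z') at h2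
    -- the ordered segments and the positions agree (sixteen orientation cases, each linear)
    have hseg : ((edgeOut z.1.1).1.1 : ℕ) = (edgeOut z'.1.1).1.1 ∧ ((edgeOut z.1.1).1.2 : ℕ) = (edgeOut z'.1.1).1.2 ∧
        ((edgeOut z.1.1).2.1 : ℕ) = (edgeOut z'.1.1).2.1 ∧ ((edgeOut z.1.1).2.2 : ℕ) = (edgeOut z'.1.1).2.2 ∨
        ((edgeOut z.1.1).1.1 : ℕ) = (edgeOut z'.1.1).2.1 ∧ ((edgeOut z.1.1).1.2 : ℕ) = (edgeOut z'.1.1).2.2 ∧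
        ((edgeOut z.1.1).2.1 : ℕ) = (edgeOut z'.1.1).1.1 ∧ ((edgeOut z.1.1).2.2 : ℕ) = (edgeOut z'.1.1).1.2 := by
      rcases hgeom z.1.1 z.2.1 with ⟨g1, g2 | g2⟩ | ⟨g1, g2 | g2⟩ <;>
        rcases hgeom z'.1.1 z'.2.1 with ⟨g1', g2' | g2'⟩ | ⟨g1', g2' | g2'⟩ <;>
        (first
          | have hX := hx_same z g1
          | have hX := hx_up z g2
          | have hX := hx_down z g2) <;>
        (first
          | have hY := hy_same z g1
          | have hY := hy_up z g2
          | have hY := hy_down z g2) <;>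
        (first
          | have hX' := hx_same z' g1'
          | have hX' := hx_up z' g2'
          | have hX' := hx_down z' g2') <;>
        (first
          | have hY' := hy_same z' g1'
          | have hY' := hy_up z' g2'
          | have hY' := hy_down z' g2') <;>
        (first
          | (left; omega)
          | (right; omega))
    have he : z.1.1 = z'.1.1 := by
      rw [← edgeOut_mk z.1.1, ← edgeOut_mk z'.1.1, Sym2.eq_iff]
      rcases hseg with ⟨a1, a2, a3, a4⟩ | ⟨a1, a2, a3, a4⟩
      · exact Or.inl ⟨Prod.ext (Fin.ext a1) (Fin.ext a2), Prod.ext (Fin.ext a3) (Fin.ext a4)⟩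
      · exact Or.inr ⟨Prod.ext (Fin.ext a1) (Fin.ext a2), Prod.ext (Fin.ext a3) (Fin.ext a4)⟩
    -- with the same edge (hence the same chosen ends) the positions agree
    obtain ⟨⟨e, t⟩, he0, ht0⟩ := z
    obtain ⟨⟨e', t'⟩, he0', ht0'⟩ := z'
    simp only at he
    subst he
    have ht : (t : ℕ) = t' := by
      rcases hgeom e he0 with ⟨g1, g2 | g2⟩ | ⟨g1, g2 | g2⟩ <;>
        (first
          | have hX := hx_same ⟨(e, t), he0, ht0⟩ g1
          | have hX := hx_up ⟨(e, t), he0, ht0⟩ g2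
          | have hX := hx_down ⟨(e, t), he0, ht0⟩ g2) <;>
        (first
          | have hY := hy_same ⟨(e, t), he0, ht0⟩ g1
          | have hY := hy_up ⟨(e, t), he0, ht0⟩ g2
          | have hY := hy_down ⟨(e, t), he0, ht0⟩ g2) <;>
        (first
          | have hX' := hx_same ⟨(e, t'), he0', ht0'⟩ g1
          | have hX' := hx_up ⟨(e, t'), he0', ht0'⟩ g2
          | have hX' := hx_down ⟨(e, t'), he0', ht0'⟩ g2) <;>
        (first
          | have hY' := hy_same ⟨(e, t'), he0', ht0'⟩ g1
          | have hY' := hy_up ⟨(e, t'), he0', ht0'⟩ g2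
          | have hY' := hy_down ⟨(e, t'), he0', ht0'⟩ g2) <;>
        (simp only at hX hY hX' hY' h1 h2 ht5 ht5'; omega)
    have ht' : t = t' := Fin.ext ht
    subst ht'
    rfl

/-- **The 5-subdivided wall is subcubic** (in the list form of `IsMinor.isTopologicalMinor_of_neighbors_le_three`).
[cite: Diestel2010, §1.7; GalesiEtAl2023, §2 (walls)] -/
theorem psubdivWall_neighbors_le_three (r : ℕ) :
    ∀ a : PSubdivVertex (wall r) (fun _ => 5) 5, ∃ l : List (PSubdivVertex (wall r) (fun _ => 5) 5),
      l.length ≤ 3 ∧ ∀ b, (psubdiv (wall r) (fun _ => 5) 5).Adj a b → b ∈ l :=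
  psubdiv_neighbors_le_three (wall_neighbors_le_three r)

/-- **LONG SUBDIVIDED WALLS FROM GRID MINORS.**  If `grid (6r) (6r) ≼ₘ F` then the 5-subdivided wall is a topological minor
of `F`: `F` contains a subdivision of `W_r` in which every wall edge is a path of length at least `6`.
[cite: Diestel2010, Prop. 1.7.2 (ii); GalesiEtAl2023, Cor. 9] -/
theorem psubdivWall_isTopologicalMinor_of_grid_isMinor {γ : Type*} {F : SimpleGraph γ} {r : ℕ}
    (hF : grid (6 * r) (6 * r) ≼ₘ F) : psubdiv (wall r) (fun _ => 5) 5 ≼ₜ F := by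
  obtain ⟨σ, hσ⟩ := exists_hom_psubdivWall_grid r
  exact isTopologicalMinor_of_subcubic_of_grid (psubdivWall_neighbors_le_three r) σ hσ hF

/-- **`W_r ≼ₘ H_r`**: the wall is a minor of its 5-subdivision (`isMinor_psubdiv`). [cite: Diestel2010, §1.7] -/
theorem isMinor_wall_psubdivWall (r : ℕ) : wall r ≼ₘ psubdiv (wall r) (fun _ => 5) 5 :=
  isMinor_psubdiv fun _ _ => le_rfl

/-- Hence `tw H_r ≥ b` whenever `2b + 1 ≤ r` (tree `le_treewidth_wall`, p841536, and `treewidth_le_of_isMinor`, p841521).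
[cite: Diestel2010, Prop. 12.3.6; GalesiEtAl2023, §2] -/
theorem le_treewidth_psubdivWall {r b : ℕ} (hb : 2 * b + 1 ≤ r) :
    b ≤ treewidth (psubdiv (wall r) (fun _ => 5) 5) :=
  (CFIHomMonotone.le_treewidth_wall hb).trans (CFIHomMonotone.treewidth_le_of_isMinor (isMinor_wall_psubdivWall r))

end Summit.ValiantsHypothesis.ValiantsHypothesis.Theorems.CFIOddCover

end
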